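import Mathlib.LinearAlgebra.Matrix.SchurComplement
import Mathlib.LinearAlgebra.Matrix.RowCol
import Mathlib.Algebra.MvPolynomial.PDeriv
import Literature.Computability.AlgebraicComplexity.LR17EquivariantRepresentations
import HarnessLib

/-!
# Landsberg–Ressayre 2017, Prop. 2.11 (upper bound) / Example 1.4 — DISCHARGE of `lr_prop_2_11_le`

Topic `Literature/Computability/AlgebraicComplexity` (cell val-lit, typer t12, row LR17-A; discharge of a
named fact of `LR17EquivariantRepresentations.lean`). Source: J. M. Landsberg, N. Ressayre,
arXiv:1508.05788 = Differential Geom. Appl. 55 (2017) [LandsbergRessayre2017], Example 1.4 (held text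
`paper:arxiv-1508.05788` p0004:L1–L62) and Prop. 2.11 / §2.4 (p0006:L84–L105).

**What is proved.** `lr_prop_2_11_le_holds : lr_prop_2_11_le`: every nondegenerate quadratic form
`Q = Σ_{ij} S_{ij} x_i x_j` (`S` symmetric, `det S` a unit) in `M ≥ 1` variables over `ℂ` has a
`𝔾_Q`-equivariant (`projLinStabilizer Q`, exact lifts) affine determinantal representation of size
`M + 1`.

**Proof (Example 1.4, adapted so that no change of coordinates and no square root is needed).** The
witness is the block matrix `Ã(x) = [[I_M, S x], [-xᵀ, 0]]` (LR's `[[0, -Xᵀ],[X, Id_M]]` for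
`Q = Σ z_j²`, p0004:L5, with the blocks permuted and `X` replaced by `S x`); by the Schur complement
`det Ã = det(0 - (-xᵀ)(S x)) = xᵀ S x = Q`. For `γ ∈ 𝔾_Q`, i.e. `γ · Q = c Q` (`c ∈ ℂˣ`; in the tree's
convention `(γ · Q)(x) = Q(γᵀ x)`), one has `γ S γᵀ = c S` at the level of the linear forms `S x`
(obtained here by differentiating the identity `Q_{γSγᵀ} = c Q_S` with `MvPolynomial.pderiv`), and then
`Ã(γ · x) = g Ã(x) h⁻¹` with the EXACT lifts `g = diag(γ⁻¹, 1)`, `h⁻¹ = diag(γ, c)` (LR use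
`diag(λ, B)`, `B` orthogonal, `λ² = c`, p0004:L6–L53; allowing `g ≠ h` removes the square root).
Nondegeneracy of `S` is not even used for this half.

No definitions, no new facts. Honest framing: a published example, formalised; nothing here bears on
lower bounds or on VP versus VNP.
-/

noncomputable section

open MvPolynomial Matrix

namespace Literature.Computability.AlgebraicComplexity

namespace LR17Quadric

variable {k : Type*} [Field k] {M : ℕ}

/-! ### The quadratic form of a matrix as the `1 × 1` matrix product `xᵀ · S · x`

Throughout, `replicateRow (Fin 1) X` is the row `xᵀ = (X_j)_j` and `replicateCol (Fin 1) X` the column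
`x = (X_i)_i` of the variables. -/

/-- `(xᵀ T x)_{00} = Σ_{ij} T_{ij} x_i x_j`. [folklore] -/
private theorem row_mul_map_mul_col (T : Matrix (Fin M) (Fin M) k) :
    (Matrix.replicateRow (Fin 1) (fun j : Fin M => (X j : MvPolynomial (Fin M) k)) * T.map (C : k →+* MvPolynomial (Fin M) k) *
        Matrix.replicateCol (Fin 1) (fun i : Fin M => (X i : MvPolynomial (Fin M) k))) 0 0 =
      ∑ i, ∑ j, C (T i j) * (X i * X j) := by
  rw [Matrix.mul_assoc, Matrix.mul_apply]
  refine Finset.sum_congr rfl fun i _ => ?_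
  rw [Matrix.replicateRow_apply, Matrix.mul_apply, Finset.mul_sum]
  refine Finset.sum_congr rfl fun j _ => ?_
  rw [Matrix.map_apply, Matrix.replicateCol_apply]
  ring

/-- The column of linear forms `(S x)_i = Σ_j S_{ij} X_j`. [folklore] -/
private theorem map_mul_col_apply (T : Matrix (Fin M) (Fin M) k) (i : Fin M) (u : Fin 1) :
    (T.map (C : k →+* MvPolynomial (Fin M) k) * Matrix.replicateCol (Fin 1) (fun i : Fin M => (X i : MvPolynomial (Fin M) k))) i u =
      ∑ j, C (T i j) * X j := by
  rw [Matrix.mul_apply]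
  refine Finset.sum_congr rfl fun j _ => ?_
  rw [Matrix.map_apply, Matrix.replicateCol_apply]

/-- Substituting `A` in the column of variables: `x ↦ Aᵀ x` (the tree's convention
`X_i ↦ Σ_j A_{ji} X_j`). [folklore] -/
private theorem col_map_linSubst (A : Matrix (Fin M) (Fin M) k) :
    (Matrix.replicateCol (Fin 1) (fun i : Fin M => (X i : MvPolynomial (Fin M) k))).map
        (linSubst (Fin M) k A) =
      (Aᵀ).map (C : k →+* MvPolynomial (Fin M) k) * Matrix.replicateCol (Fin 1) (fun i : Fin M => (X i : MvPolynomial (Fin M) k)) := by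
  funext i u
  rw [Matrix.map_apply, Matrix.replicateCol_apply, linSubst_X, Matrix.mul_apply]
  refine Finset.sum_congr rfl fun j _ => ?_
  rw [Matrix.map_apply, Matrix.transpose_apply, Matrix.replicateCol_apply, smul_eq_C_mul]

/-- Substituting `A` in the row of variables: `xᵀ ↦ xᵀ A`. [folklore] -/
private theorem row_map_linSubst (A : Matrix (Fin M) (Fin M) k) :
    (Matrix.replicateRow (Fin 1) (fun j : Fin M => (X j : MvPolynomial (Fin M) k))).map
        (linSubst (Fin M) k A) =
      Matrix.replicateRow (Fin 1) (fun j : Fin M => (X j : MvPolynomial (Fin M) k)) * A.map (C : k →+* MvPolynomial (Fin M) k) := by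
  funext u j
  rw [Matrix.map_apply, Matrix.replicateRow_apply, linSubst_X, Matrix.mul_apply]
  refine Finset.sum_congr rfl fun l _ => ?_
  rw [Matrix.map_apply, Matrix.replicateRow_apply, smul_eq_C_mul, mul_comm]

/-- Constant matrices are fixed by a substitution of the variables. [folklore] -/
private theorem map_C_map_linSubst {m n : Type*} (A : Matrix (Fin M) (Fin M) k) (T : Matrix m n k) :
    (T.map (C : k →+* MvPolynomial (Fin M) k)).map (linSubst (Fin M) k A) = T.map (C : k →+* MvPolynomial (Fin M) k) := by
  funext i j
  simp only [Matrix.map_apply, linSubst_C]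

/-- `A · Q_S = Q_{A S Aᵀ}`: a linear substitution acts on the matrix of a quadratic form by congruence
(p0004:L3, there for orthogonal `B`). [cite: LandsbergRessayre2017, Example 1.4] -/
theorem linSubst_quadForm (A S : Matrix (Fin M) (Fin M) k) :
    linSubst (Fin M) k A (∑ i, ∑ j, C (S i j) * (X i * X j)) =
      ∑ i, ∑ j, C ((A * S * Aᵀ) i j) * (X i * X j) := by
  rw [← row_mul_map_mul_col, ← row_mul_map_mul_col,
    ← Matrix.map_apply (f := linSubst (Fin M) k A), Matrix.map_mul, Matrix.map_mul,
    map_C_map_linSubst, row_map_linSubst, col_map_linSubst, Matrix.map_mul, Matrix.map_mul,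
    ← Matrix.mul_assoc, ← Matrix.mul_assoc, ← Matrix.mul_assoc]

variable [DecidableEq (Fin M)] in
/-- `∂/∂x_l (Σ_{ij} T_{ij} x_i x_j) = Σ_j T_{lj} x_j + Σ_i T_{il} x_i`. [folklore] -/
private theorem pderiv_quadForm (T : Matrix (Fin M) (Fin M) k) (l : Fin M) :
    pderiv l (∑ i, ∑ j, C (T i j) * (X i * X j) : MvPolynomial (Fin M) k) =
      ∑ j, C (T l j) * X j + ∑ i, C (T i l) * X i := by
  have hterm : ∀ i j : Fin M, pderiv l (C (T i j) * (X i * X j) : MvPolynomial (Fin M) k) =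
      (if i = l then C (T i j) * X j else 0) + (if j = l then C (T i j) * X i else 0) := by
    intro i j
    rw [pderiv_C_mul, pderiv_mul, pderiv_X, pderiv_X, Pi.single_apply, Pi.single_apply]
    split_ifs <;> ring
  simp_rw [map_sum, hterm, Finset.sum_add_distrib]
  congr 1
  · rw [Finset.sum_comm]
    simp only [Finset.sum_ite_eq', Finset.mem_univ, if_true]
  · simp only [Finset.sum_ite_eq', Finset.mem_univ, if_true]

variable [DecidableEq (Fin M)] in
/-- For symmetric `T`, `∂/∂x_l (xᵀ T x) = 2 (T x)_l`. [folklore] -/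
private theorem pderiv_quadForm_of_isSymm {T : Matrix (Fin M) (Fin M) k} (hT : T.IsSymm) (l : Fin M) :
    pderiv l (∑ i, ∑ j, C (T i j) * (X i * X j) : MvPolynomial (Fin M) k) =
      (2 : k) • ∑ j, C (T l j) * X j := by
  rw [pderiv_quadForm, two_smul]
  congr 1
  exact Finset.sum_congr rfl fun i _ => by rw [hT.apply l i]

/-- Congruence preserves symmetry: `(P S Pᵀ)ᵀ = P S Pᵀ` for symmetric `S`. [folklore] -/
private theorem isSymm_conj {S : Matrix (Fin M) (Fin M) k} (hS : S.IsSymm) (P : Matrix (Fin M) (Fin M) k) :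
    (P * S * Pᵀ).IsSymm := by
  unfold Matrix.IsSymm
  rw [Matrix.transpose_mul, Matrix.transpose_mul, Matrix.transpose_transpose, hS.eq, Matrix.mul_assoc]

variable [DecidableEq (Fin M)] in
/-- **`γ ∈ 𝔾_Q ⇒ γ S γᵀ = c S` on the linear forms `S x`**: if `γ · Q_S = c • Q_S` (`S` symmetric,
characteristic `0`) then `(γ S γᵀ) x = c • (S x)` as columns of linear forms — by differentiating
`Q_{γSγᵀ} = c Q_S`. (For `Q = Σ z_j²`: `𝔾_Q = ℂ* × O(M)`, p0004:L2–L3.) [cite: LandsbergRessayre2017, Example 1.4] -/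
theorem conj_map_mul_col_eq_smul [CharZero k] {S : Matrix (Fin M) (Fin M) k} (hS : S.IsSymm)
    {A : Matrix (Fin M) (Fin M) k} {c : k}
    (hγ : linSubst (Fin M) k A (∑ i, ∑ j, C (S i j) * (X i * X j)) =
      c • ∑ i, ∑ j, C (S i j) * (X i * X j)) :
    (A * S * Aᵀ).map (C : k →+* MvPolynomial (Fin M) k) * Matrix.replicateCol (Fin 1) (fun i : Fin M => (X i : MvPolynomial (Fin M) k)) =
      c • (S.map (C : k →+* MvPolynomial (Fin M) k) * Matrix.replicateCol (Fin 1) (fun i : Fin M => (X i : MvPolynomial (Fin M) k))) := by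
  rw [linSubst_quadForm] at hγ
  funext l u
  rw [Matrix.smul_apply, map_mul_col_apply, map_mul_col_apply]
  have h := congrArg (pderiv l) hγ
  rw [Derivation.map_smul, pderiv_quadForm_of_isSymm (isSymm_conj hS _), pderiv_quadForm_of_isSymm hS,
    smul_comm] at h
  exact smul_right_injective (MvPolynomial (Fin M) k) (two_ne_zero' k) h

/-! ### The witness `[[I_M, S x], [-xᵀ, 0]]` -/

/-- Entries of the witness have total degree `≤ 1`. [cite: LandsbergRessayre2017, Example 1.4] -/
theorem totalDegree_fromBlocks_le (S : Matrix (Fin M) (Fin M) k) (a b : Fin M ⊕ Fin 1) :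
    (Matrix.fromBlocks (1 : Matrix (Fin M) (Fin M) (MvPolynomial (Fin M) k))
        (S.map (C : k →+* MvPolynomial (Fin M) k) * Matrix.replicateCol (Fin 1) (fun i : Fin M => (X i : MvPolynomial (Fin M) k)))
        (-Matrix.replicateRow (Fin 1) (fun j : Fin M => (X j : MvPolynomial (Fin M) k)))
        0 a b).totalDegree ≤ 1 := by
  rcases a with i | u <;> rcases b with j | v
  · rw [Matrix.fromBlocks_apply₁₁, Matrix.one_apply]
    split_ifs <;> simp
  · rw [Matrix.fromBlocks_apply₁₂, map_mul_col_apply]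
    refine totalDegree_finsetSum_le fun j _ => (totalDegree_mul _ _).trans ?_
    rw [totalDegree_C, zero_add]
    exact (totalDegree_X _).le
  · rw [Matrix.fromBlocks_apply₂₁, Matrix.neg_apply, Matrix.replicateRow_apply, totalDegree_neg]
    exact (totalDegree_X _).le
  · rw [Matrix.fromBlocks_apply₂₂, Matrix.zero_apply, totalDegree_zero]
    exact zero_le_one

/-- **Schur complement:** `det [[I, S x], [-xᵀ, 0]] = xᵀ S x = Q_S` (p0004:L5, L56–L59).
[cite: LandsbergRessayre2017, Example 1.4] -/
theorem det_fromBlocks_eq (S : Matrix (Fin M) (Fin M) k) :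
    (Matrix.fromBlocks (1 : Matrix (Fin M) (Fin M) (MvPolynomial (Fin M) k))
        (S.map (C : k →+* MvPolynomial (Fin M) k) * Matrix.replicateCol (Fin 1) (fun i : Fin M => (X i : MvPolynomial (Fin M) k)))
        (-Matrix.replicateRow (Fin 1) (fun j : Fin M => (X j : MvPolynomial (Fin M) k)))
        0).det = ∑ i, ∑ j, C (S i j) * (X i * X j) := by
  rw [Matrix.det_fromBlocks_one₁₁, Matrix.det_unique, Matrix.sub_apply, Matrix.zero_apply,
    Matrix.neg_mul, Matrix.neg_apply, zero_sub, neg_neg, ← Matrix.mul_assoc, ← row_mul_map_mul_col]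
  rfl

/-- Reindexed products: `(e·P·e⁻¹)(e·N·e⁻¹) = e·(P N)·e⁻¹`. [folklore] -/
private theorem reindex_mul_reindex {α : Type*} [CommRing α] {n : ℕ} (e : Fin M ⊕ Fin 1 ≃ Fin n)
    (P N : Matrix (Fin M ⊕ Fin 1) (Fin M ⊕ Fin 1) α) :
    Matrix.reindex e e P * Matrix.reindex e e N = Matrix.reindex e e (P * N) := by
  simp only [Matrix.reindex_apply, Matrix.submatrix_mul_equiv]

variable [DecidableEq (Fin M)] in
/-- The block-diagonal unit `diag(P, u)` (`P ∈ GL_M`, `u ∈ kˣ`) transported to `Fin n` along `e`,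
with inverse `diag(P⁻¹, u⁻¹)`. [folklore] -/
private theorem exists_blockUnit {n : ℕ} (e : Fin M ⊕ Fin 1 ≃ Fin n) (P : GL (Fin M) k) (u : kˣ) :
    ∃ g : GL (Fin n) k,
      (g : Matrix (Fin n) (Fin n) k) =
          Matrix.reindex e e (Matrix.fromBlocks (P : Matrix (Fin M) (Fin M) k) 0 0 ((u : k) • 1)) ∧
        ((g⁻¹ : GL (Fin n) k) : Matrix (Fin n) (Fin n) k) =
          Matrix.reindex e e (Matrix.fromBlocks ((P⁻¹ : GL (Fin M) k) : Matrix (Fin M) (Fin M) k) 0 0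
            (((u⁻¹ : kˣ) : k) • 1)) := by
  have h1 : Matrix.reindex e e (Matrix.fromBlocks (P : Matrix (Fin M) (Fin M) k) 0 0 ((u : k) • 1)) *
      Matrix.reindex e e (Matrix.fromBlocks ((P⁻¹ : GL (Fin M) k) : Matrix (Fin M) (Fin M) k) 0 0
        (((u⁻¹ : kˣ) : k) • 1)) = 1 := by
    rw [reindex_mul_reindex, Matrix.fromBlocks_multiply]
    simp only [Matrix.mul_zero, Matrix.zero_mul, add_zero, zero_add, smul_zero, Units.mul_inv,
      Matrix.mul_smul, Matrix.mul_one, smul_smul, Units.inv_mul, one_smul,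
      Matrix.fromBlocks_one, Matrix.reindex_apply, Matrix.submatrix_one_equiv]
  have h2 : Matrix.reindex e e (Matrix.fromBlocks ((P⁻¹ : GL (Fin M) k) : Matrix (Fin M) (Fin M) k) 0 0
        (((u⁻¹ : kˣ) : k) • 1)) *
      Matrix.reindex e e (Matrix.fromBlocks (P : Matrix (Fin M) (Fin M) k) 0 0 ((u : k) • 1)) = 1 := by
    rw [reindex_mul_reindex, Matrix.fromBlocks_multiply]
    simp only [Matrix.mul_zero, Matrix.zero_mul, add_zero, zero_add, smul_zero, Units.inv_mul,
      Matrix.mul_smul, Matrix.mul_one, smul_smul, Units.mul_inv, one_smul,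
      Matrix.fromBlocks_one, Matrix.reindex_apply, Matrix.submatrix_one_equiv]
  exact ⟨⟨_, _, h1, h2⟩, rfl, rfl⟩

end LR17Quadric

open LR17Quadric in
/-- **DISCHARGE of `lr_prop_2_11_le`** (LR17 Prop. 2.11, upper bound; Example 1.4): for `M ≥ 1` and a
nondegenerate quadratic form `Q = Σ S_{ij} x_i x_j` over `ℂ`, the matrix `[[I_M, S x], [-xᵀ, 0]]`
(reindexed to `Fin (M+1)`) is a `𝔾_Q`-equivariant affine determinantal representation of `Q` of size
`M + 1`, with exact lifts `g = diag(γ⁻¹, 1)`, `h⁻¹ = diag(γ, c)` for `γ · Q = c Q`.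
[cite: LandsbergRessayre2017, Prop. 2.11] -/
theorem lr_prop_2_11_le_holds : lr_prop_2_11_le := by
  intro M _hM Q hQ
  obtain ⟨S, hS, -, rfl⟩ := hQ
  classical
  -- the witness
  refine ⟨Matrix.reindex finSumFinEquiv finSumFinEquiv
      (Matrix.fromBlocks (1 : Matrix (Fin M) (Fin M) (MvPolynomial (Fin M) ℂ))
        (S.map (C : ℂ →+* MvPolynomial (Fin M) ℂ) * Matrix.replicateCol (Fin 1) (fun i : Fin M => (X i : MvPolynomial (Fin M) ℂ)))
        (-Matrix.replicateRow (Fin 1) (fun j : Fin M => (X j : MvPolynomial (Fin M) ℂ))) 0),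
    ⟨fun a b => ?_, ?_⟩, fun γ hγ => ?_⟩
  · -- affine entries
    rw [Matrix.reindex_apply, Matrix.submatrix_apply]
    exact totalDegree_fromBlocks_le S _ _
  · -- determinant
    rw [Matrix.det_reindex_self]
    exact det_fromBlocks_eq S
  · -- exact lifts
    obtain ⟨c, hc⟩ := mem_projLinStabilizer.mp hγ
    rw [linSubstRep_apply] at hc
    have key := conj_map_mul_col_eq_smul hS hc
    obtain ⟨g, hg, -⟩ := exists_blockUnit (finSumFinEquiv : Fin M ⊕ Fin 1 ≃ Fin (M + 1)) γ⁻¹ (1 : ℂˣ)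
    obtain ⟨h, -, hh⟩ := exists_blockUnit (finSumFinEquiv : Fin M ⊕ Fin 1 ≃ Fin (M + 1)) γ⁻¹ c⁻¹
    refine ⟨g, h, ?_⟩
    rw [hg, hh, inv_inv, inv_inv, Units.val_one, one_smul]
    -- bookkeeping: constant / substituted blocks
    have hC0a : (0 : Matrix (Fin M) (Fin 1) ℂ).map (C : ℂ →+* MvPolynomial (Fin M) ℂ) = 0 :=
      Matrix.map_zero _ (map_zero _)
    have hC0b : (0 : Matrix (Fin 1) (Fin M) ℂ).map (C : ℂ →+* MvPolynomial (Fin M) ℂ) = 0 :=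
      Matrix.map_zero _ (map_zero _)
    have hC1 : (1 : Matrix (Fin 1) (Fin 1) ℂ).map (C : ℂ →+* MvPolynomial (Fin M) ℂ) = 1 :=
      Matrix.map_one _ (map_zero _) (map_one _)
    have hCc : ((c : ℂ) • (1 : Matrix (Fin 1) (Fin 1) ℂ)).map (C : ℂ →+* MvPolynomial (Fin M) ℂ) =
        (c : ℂ) • (1 : Matrix (Fin 1) (Fin 1) (MvPolynomial (Fin M) ℂ)) := by
      rw [Matrix.map_smul _ _ (fun a => by rw [smul_eq_mul, map_mul, smul_eq_C_mul]), hC1]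
    have hL0 : (0 : Matrix (Fin 1) (Fin 1) (MvPolynomial (Fin M) ℂ)).map
        (linSubst (Fin M) ℂ (γ : Matrix (Fin M) (Fin M) ℂ)) = 0 := Matrix.map_zero _ (map_zero _)
    have hL1 : (1 : Matrix (Fin M) (Fin M) (MvPolynomial (Fin M) ℂ)).map
        (linSubst (Fin M) ℂ (γ : Matrix (Fin M) (Fin M) ℂ)) = 1 :=
      Matrix.map_one _ (map_zero _) (map_one _)
    have hLneg : (-Matrix.replicateRow (Fin 1) (fun j : Fin M => (X j : MvPolynomial (Fin M) ℂ))).map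
          (linSubst (Fin M) ℂ (γ : Matrix (Fin M) (Fin M) ℂ)) =
        -(Matrix.replicateRow (Fin 1) (fun j : Fin M => (X j : MvPolynomial (Fin M) ℂ)) *
          (γ : Matrix (Fin M) (Fin M) ℂ).map (C : ℂ →+* MvPolynomial (Fin M) ℂ)) := by
      rw [Matrix.map_neg _ (map_neg _), row_map_linSubst]
    have hLB : (S.map (C : ℂ →+* MvPolynomial (Fin M) ℂ) *
            Matrix.replicateCol (Fin 1) (fun i : Fin M => (X i : MvPolynomial (Fin M) ℂ))).map
          (linSubst (Fin M) ℂ (γ : Matrix (Fin M) (Fin M) ℂ)) =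
        (S * (γ : Matrix (Fin M) (Fin M) ℂ)ᵀ).map (C : ℂ →+* MvPolynomial (Fin M) ℂ) *
          Matrix.replicateCol (Fin 1) (fun i : Fin M => (X i : MvPolynomial (Fin M) ℂ)) := by
      rw [Matrix.map_mul, map_C_map_linSubst, col_map_linSubst, ← Matrix.mul_assoc, ← Matrix.map_mul]
    have hmat : ((γ⁻¹ : GL (Fin M) ℂ) : Matrix (Fin M) (Fin M) ℂ) *
        ((γ : Matrix (Fin M) (Fin M) ℂ) * S * (γ : Matrix (Fin M) (Fin M) ℂ)ᵀ) =
          S * (γ : Matrix (Fin M) (Fin M) ℂ)ᵀ := by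
      rw [Matrix.mul_assoc (γ : Matrix (Fin M) (Fin M) ℂ), ← Matrix.mul_assoc, ← Units.val_mul,
        inv_mul_cancel, Units.val_one, Matrix.one_mul]
    -- both sides are reindexed block matrices; compare block by block
    rw [Matrix.linSubstEntries, Matrix.reindex_apply, Matrix.reindex_apply, Matrix.reindex_apply,
      ← Matrix.submatrix_map, ← Matrix.submatrix_map, ← Matrix.submatrix_map, Matrix.submatrix_mul_equiv,
      Matrix.submatrix_mul_equiv, Matrix.fromBlocks_map, Matrix.fromBlocks_map, Matrix.fromBlocks_map,
      hC0a, hC0b, hC1, hCc, hL0, hL1, hLneg, hLB, Matrix.fromBlocks_multiply, Matrix.fromBlocks_multiply]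
    simp only [Matrix.mul_zero, Matrix.zero_mul, add_zero, zero_add, Matrix.one_mul, Matrix.mul_one,
      Matrix.mul_smul, Matrix.neg_mul, smul_zero]
    congr 1
    rw [Matrix.fromBlocks_inj]
    refine ⟨?_, ?_, rfl, rfl⟩
    · -- `1 = γ⁻¹ γ`
      rw [← Matrix.map_mul, ← Units.val_mul, inv_mul_cancel, Units.val_one,
        Matrix.map_one _ (map_zero _) (map_one _)]
    · -- the linear forms: `S γᵀ x = c γ⁻¹ S x`
      calc (S * (γ : Matrix (Fin M) (Fin M) ℂ)ᵀ).map (C : ℂ →+* MvPolynomial (Fin M) ℂ) *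
            Matrix.replicateCol (Fin 1) (fun i : Fin M => (X i : MvPolynomial (Fin M) ℂ))
          = ((γ⁻¹ : GL (Fin M) ℂ) : Matrix (Fin M) (Fin M) ℂ).map (C : ℂ →+* MvPolynomial (Fin M) ℂ) *
            (((γ : Matrix (Fin M) (Fin M) ℂ) * S * (γ : Matrix (Fin M) (Fin M) ℂ)ᵀ).map
                (C : ℂ →+* MvPolynomial (Fin M) ℂ) *
              Matrix.replicateCol (Fin 1) (fun i : Fin M => (X i : MvPolynomial (Fin M) ℂ))) := by
            rw [← Matrix.mul_assoc, ← Matrix.map_mul, hmat]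
        _ = (c : ℂ) • (((γ⁻¹ : GL (Fin M) ℂ) : Matrix (Fin M) (Fin M) ℂ).map
              (C : ℂ →+* MvPolynomial (Fin M) ℂ) *
            (S.map (C : ℂ →+* MvPolynomial (Fin M) ℂ) *
              Matrix.replicateCol (Fin 1) (fun i : Fin M => (X i : MvPolynomial (Fin M) ℂ)))) := by
            rw [key, Matrix.mul_smul]

end Literature.Computability.AlgebraicComplexity

end
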